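import Mathlib.RingTheory.Length
import Mathlib.Algebra.Module.SnakeLemma
import Mathlib.RingTheory.QuotSMulTop
import Mathlib.Algebra.Module.Torsion.Basic
import Mathlib.RingTheory.Localization.AtPrime.Basic
import Mathlib.RingTheory.Localization.Module
import Mathlib.Algebra.Module.LocalizedModule.Exact
import Mathlib.RingTheory.SimpleModule.Basic
import HarnessLib

/-!
# Lengths of `a`-torsion, of `M/aM` and of localisations along exact sequences

Auxiliary length bookkeeping for Fulton's Lemma A.2.7 (`Literature/RingTheory/Length/MinimalPrimes.lean`;
Fulton, *Intersection Theory*, 2nd ed. 1998, Appendix A.1–A.2): for a short exact sequence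
`0 → N₁ → N₂ → N₃ → 0` of modules over a commutative ring `R` and `a ∈ R`,

* the snake lemma for multiplication by `a` (Mathlib `SnakeLemma.δ'`) yields the exact sequence
  `0 → N₁[a] → N₂[a] → N₃[a] → N₁/aN₁ → N₂/aN₂ → N₃/aN₃ → 0`, whence
  `ℓ(N₂[a]) + ℓ(N₁/a) + ℓ(N₃/a) = ℓ(N₁[a]) + ℓ(N₃[a]) + ℓ(N₂/a)` in `ℕ∞`
  (`Literature.RingTheory.Length.length_snake`; Fulton Lemma A.2.4 with Lemma A.1.1) — stated
  additively, so that no finiteness is required;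
* localisation at a prime `p` is exact, so `ℓ_{R_p}((N₂)_p) = ℓ_{R_p}((N₁)_p) + ℓ_{R_p}((N₃)_p)`
  (`length_localized_eq_add`), and `(R/I)_p = 0` for `I ⊄ p`, `ℓ_{R_p}((R/p)_p) = 1`
  (`subsingleton_localized_quotient`, `length_localized_quotient_self`; Fulton Lemma A.1.2 and the
  proof of Lemma A.2.7).

Here `N/aN = QuotSMulTop a N`, `N[a] = Submodule.torsionBy R N a`, `N_p = LocalizedModule p.primeCompl N`
(Mathlib). Mathlib has the snake lemma and the exactness of localisation but not these length
identities (searched: `length_snake`, `torsionBy.*length`, `length_localized` — nothing).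

## References

* W. Fulton, *Intersection Theory*, 2nd ed., Springer 1998, Appendix A.1 (Lemmas A.1.1, A.1.2),
  A.2 (Definition A.2, Lemmas A.2.1, A.2.4, A.2.7).
-/


open Function
open scoped Pointwise

namespace Literature.RingTheory.Length

universe u v

variable {R : Type*} [CommRing R]

section TorsionBy

variable (a : R) {N₁ N₂ N₃ : Type*}
  [AddCommGroup N₁] [Module R N₁] [AddCommGroup N₂] [Module R N₂] [AddCommGroup N₃] [Module R N₃]

/-! ### The `a`-torsion functor `M ↦ M[a]` is left exact -/

/-- A linear map sends `a`-torsion to `a`-torsion. [folklore] -/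
lemma mapsTo_torsionBy (h : N₁ →ₗ[R] N₂) :
    ∀ x ∈ Submodule.torsionBy R N₁ a, h x ∈ Submodule.torsionBy R N₂ a := fun x hx ↦ by
  simp only [Submodule.mem_torsionBy_iff] at hx ⊢
  rw [← map_smul, hx, map_zero]

/-- An injective linear map restricts to an injective map on `a`-torsion. [folklore] -/
lemma restrict_torsionBy_injective (h : N₁ →ₗ[R] N₂) (hh : Injective h) :
    Injective (h.restrict (mapsTo_torsionBy a h)) := fun x y hxy ↦
  Subtype.ext (hh (by simpa [LinearMap.restrict_apply] using congrArg Subtype.val hxy))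

/-- For `0 → N₁ → N₂ → N₃` exact, `0 → N₁[a] → N₂[a] → N₃[a]` is exact at `N₂[a]` (left
exactness of the `a`-torsion). [folklore] -/
lemma exact_restrict_torsionBy (f : N₁ →ₗ[R] N₂) (g : N₂ →ₗ[R] N₃) (hf : Injective f)
    (hfg : Exact f g) : Exact (f.restrict (mapsTo_torsionBy a f)) (g.restrict (mapsTo_torsionBy a g)) := by
  intro x
  constructor
  · intro hx
    have hx' : g x.1 = 0 := by simpa [LinearMap.restrict_apply] using congrArg Subtype.val hx
    obtain ⟨y, hy⟩ := (hfg x.1).mp hx'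
    refine ⟨⟨y, ?_⟩, ?_⟩
    · simp only [Submodule.mem_torsionBy_iff]
      apply hf
      rw [map_smul, hy, map_zero]
      exact (Submodule.mem_torsionBy_iff a x.1).mp x.2
    · apply Subtype.ext
      simpa [LinearMap.restrict_apply] using hy
  · rintro ⟨y, rfl⟩
    apply Subtype.ext
    simp [LinearMap.restrict_apply, hfg.apply_apply_eq_zero]

/-- Isomorphic modules have `a`-torsion of the same length. [folklore] -/
lemma length_torsionBy_eq_of_equiv (e : N₁ ≃ₗ[R] N₂) :
    Module.length R (Submodule.torsionBy R N₁ a) = Module.length R (Submodule.torsionBy R N₂ a) :=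
  le_antisymm
    (Module.length_le_of_injective _ (restrict_torsionBy_injective a e.toLinearMap e.injective))
    (Module.length_le_of_injective _ (restrict_torsionBy_injective a e.symm.toLinearMap e.symm.injective))

/-- For `0 → N₁ → N₂ → N₃` exact, `ℓ(N₂[a]) ≤ ℓ(N₁[a]) + ℓ(N₃[a])`. [folklore] -/
lemma length_torsionBy_le (f : N₁ →ₗ[R] N₂) (g : N₂ →ₗ[R] N₃) (hf : Injective f)
    (hfg : Exact f g) :
    Module.length R (Submodule.torsionBy R N₂ a) ≤
      Module.length R (Submodule.torsionBy R N₁ a) + Module.length R (Submodule.torsionBy R N₃ a) := by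
  rw [Module.length_eq_add_of_exact (LinearMap.ker (g.restrict (mapsTo_torsionBy a g))).subtype
    (g.restrict (mapsTo_torsionBy a g)).rangeRestrict (Submodule.injective_subtype _)
    (g.restrict (mapsTo_torsionBy a g)).surjective_rangeRestrict
    (LinearMap.exact_iff.mpr (by rw [LinearMap.ker_rangeRestrict, Submodule.range_subtype]))]
  gcongr
  · rw [(LinearMap.exact_iff.mp (exact_restrict_torsionBy a f g hf hfg) : LinearMap.ker _ = _)]
    exact (LinearEquiv.ofInjective _ (restrict_torsionBy_injective a f hf)).length_eq.symm.le
  · exact Module.length_le_of_injective _ (Submodule.injective_subtype _)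

end TorsionBy

section SixTerm

variable {M₁ M₂ M₃ M₄ M₅ M₆ : Type*}
  [AddCommGroup M₁] [Module R M₁] [AddCommGroup M₂] [Module R M₂] [AddCommGroup M₃] [Module R M₃]
  [AddCommGroup M₄] [Module R M₄] [AddCommGroup M₅] [Module R M₅] [AddCommGroup M₆] [Module R M₆]

/-! ### Lengths in a six-term exact sequence -/

/-- Rank–nullity for lengths: `ℓ(M) = ℓ(ker h) + ℓ(range h)` (Mathlib
`Module.length_eq_add_of_exact`). [folklore] -/
lemma length_eq_length_ker_add_length_range (h : M₁ →ₗ[R] M₂) :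
    Module.length R M₁ = Module.length R (LinearMap.ker h) + Module.length R (LinearMap.range h) :=
  Module.length_eq_add_of_exact (LinearMap.ker h).subtype h.rangeRestrict
    (Submodule.injective_subtype _) h.surjective_rangeRestrict
    (LinearMap.exact_iff.mpr (by rw [LinearMap.ker_rangeRestrict, Submodule.range_subtype]))

/-- For an exact sequence `0 → M₁ → M₂ → M₃ → M₄ → M₅ → M₆ → 0` of modules, the lengths satisfy
`ℓ₂ + ℓ₄ + ℓ₆ = ℓ₁ + ℓ₃ + ℓ₅` in `ℕ∞` — the alternating-sum identity of Fulton, Lemma A.1.1,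
written without subtraction so that no finiteness is needed (split into short exact sequences at
the images). [cite: Fulton1998, Lemma A.1.1] -/
lemma length_six_term (f₁ : M₁ →ₗ[R] M₂) (f₂ : M₂ →ₗ[R] M₃) (f₃ : M₃ →ₗ[R] M₄)
    (f₄ : M₄ →ₗ[R] M₅) (f₅ : M₅ →ₗ[R] M₆) (h₁ : Injective f₁) (h₂ : Exact f₁ f₂)
    (h₃ : Exact f₂ f₃) (h₄ : Exact f₃ f₄) (h₅ : Exact f₄ f₅) (h₆ : Surjective f₅) :
    Module.length R M₂ + Module.length R M₄ + Module.length R M₆ =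
      Module.length R M₁ + Module.length R M₃ + Module.length R M₅ := by
  have e₂ := length_eq_length_ker_add_length_range f₂
  have e₃ := length_eq_length_ker_add_length_range f₃
  have e₄ := length_eq_length_ker_add_length_range f₄
  have e₅ := length_eq_length_ker_add_length_range f₅
  rw [(LinearMap.exact_iff.mp h₂ : LinearMap.ker f₂ = _)] at e₂
  rw [(LinearMap.exact_iff.mp h₃ : LinearMap.ker f₃ = _)] at e₃
  rw [(LinearMap.exact_iff.mp h₄ : LinearMap.ker f₄ = _)] at e₄
  rw [(LinearMap.exact_iff.mp h₅ : LinearMap.ker f₅ = _)] at e₅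
  have r₁ : Module.length R (LinearMap.range f₁) = Module.length R M₁ :=
    (LinearEquiv.ofInjective f₁ h₁).length_eq.symm
  have r₅ : Module.length R (LinearMap.range f₅) = Module.length R M₆ := by
    rw [LinearMap.range_eq_top.mpr h₆]
    exact Submodule.topEquiv.length_eq
  rw [r₁] at e₂
  rw [r₅] at e₅
  rw [e₂, e₃, e₄, e₅]
  ring

end SixTerm

section Snake

variable (a : R) {N₁ N₂ N₃ : Type*}
  [AddCommGroup N₁] [Module R N₁] [AddCommGroup N₂] [Module R N₂] [AddCommGroup N₃] [Module R N₃]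
  (f : N₁ →ₗ[R] N₂) (g : N₂ →ₗ[R] N₃) (hf : Injective f) (hg : Surjective g) (hfg : Exact f g)

/-! ### The snake lemma for multiplication by `a` -/

/-- The image of multiplication by `a` on `N` is the submodule `a • N`. [folklore] -/
lemma range_smulMap (N : Type*) [AddCommGroup N] [Module R N] :
    LinearMap.range (DistribSMul.toLinearMap R N a) = a • (⊤ : Submodule R N) := by
  rw [LinearMap.range_eq_map]
  rfl

/-- `N -a→ N → N/aN` is exact. [folklore] -/
lemma exact_smulMap_mkQ (N : Type*) [AddCommGroup N] [Module R N] :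
    Exact (DistribSMul.toLinearMap R N a) (Submodule.mkQ (a • (⊤ : Submodule R N))) := by
  rw [LinearMap.exact_iff, Submodule.ker_mkQ, range_smulMap]

/-- `N[a] → N -a→ N` is exact. [folklore] -/
lemma exact_subtype_smulMap (N : Type*) [AddCommGroup N] [Module R N] :
    Exact (Submodule.torsionBy R N a).subtype (DistribSMul.toLinearMap R N a) :=
  LinearMap.exact_subtype_ker_map _

include hf hg hfg in
/-- **Additivity of `e_A(a, ·)`** (Fulton, *Intersection Theory*, Lemma A.2.4 for `φ = a`): for a
short exact sequence `0 → N₁ → N₂ → N₃ → 0` and `a ∈ R`, the snake lemma for multiplication by `a`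
(Mathlib `SnakeLemma.δ'`) gives the exact sequence
`0 → N₁[a] → N₂[a] → N₃[a] → N₁/aN₁ → N₂/aN₂ → N₃/aN₃ → 0`, whence
`ℓ(N₂[a]) + ℓ(N₁/a) + ℓ(N₃/a) = ℓ(N₁[a]) + ℓ(N₃[a]) + ℓ(N₂/a)` in `ℕ∞`. [cite: Fulton1998, Lemma A.2.4] -/
lemma length_snake :
    Module.length R (Submodule.torsionBy R N₂ a) + Module.length R (QuotSMulTop a N₁) +
        Module.length R (QuotSMulTop a N₃) =
      Module.length R (Submodule.torsionBy R N₁ a) + Module.length R (Submodule.torsionBy R N₃ a) +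
        Module.length R (QuotSMulTop a N₂) := by
  have hsq₁ : f.comp (DistribSMul.toLinearMap R N₁ a) = (DistribSMul.toLinearMap R N₂ a).comp f := by ext; simp
  have hsq₂ : g.comp (DistribSMul.toLinearMap R N₂ a) = (DistribSMul.toLinearMap R N₃ a).comp g := by ext; simp
  let δ := SnakeLemma.δ' (DistribSMul.toLinearMap R N₁ a) (DistribSMul.toLinearMap R N₂ a) (DistribSMul.toLinearMap R N₃ a) f g hfg f g hfg hsq₁ hsq₂
    (Submodule.torsionBy R N₃ a).subtype (exact_subtype_smulMap a N₃)
    (Submodule.mkQ (a • ⊤)) (exact_smulMap_mkQ a N₁) hg hf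
  refine length_six_term (f.restrict (mapsTo_torsionBy a f)) (g.restrict (mapsTo_torsionBy a g)) δ (QuotSMulTop.map a f)
    (QuotSMulTop.map a g) ?_ ?_ ?_ ?_ (QuotSMulTop.map_exact a hfg hg) (QuotSMulTop.map_surjective a hg)
  · intro x y hxy
    apply Subtype.ext
    apply hf
    simpa [LinearMap.restrict_apply] using congrArg Subtype.val hxy
  · intro x
    constructor
    · intro hx
      have hx' : g x.1 = 0 := by simpa [LinearMap.restrict_apply] using congrArg Subtype.val hx
      obtain ⟨y, hy⟩ := (hfg x.1).mp hx'
      refine ⟨⟨y, ?_⟩, ?_⟩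
      · simp only [Submodule.mem_torsionBy_iff]
        apply hf
        rw [map_smul, hy, map_zero]
        exact (Submodule.mem_torsionBy_iff a x.1).mp x.2
      · apply Subtype.ext
        simpa [LinearMap.restrict_apply] using hy
    · rintro ⟨y, rfl⟩
      apply Subtype.ext
      simp [LinearMap.restrict_apply, hfg.apply_apply_eq_zero]
  · exact SnakeLemma.exact_δ'_right (DistribSMul.toLinearMap R N₁ a) (DistribSMul.toLinearMap R N₂ a) (DistribSMul.toLinearMap R N₃ a) f g hfg f g hfg
      hsq₁ hsq₂ (Submodule.torsionBy R N₂ a).subtype (exact_subtype_smulMap a N₂)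
      (Submodule.torsionBy R N₃ a).subtype (exact_subtype_smulMap a N₃)
      (Submodule.mkQ (a • ⊤)) (exact_smulMap_mkQ a N₁) hg hf (g.restrict (mapsTo_torsionBy a g)) rfl
      (Submodule.injective_subtype _)
  · exact SnakeLemma.exact_δ'_left (DistribSMul.toLinearMap R N₁ a) (DistribSMul.toLinearMap R N₂ a) (DistribSMul.toLinearMap R N₃ a) f g hfg f g hfg
      hsq₁ hsq₂ (Submodule.torsionBy R N₃ a).subtype (exact_subtype_smulMap a N₃)
      (Submodule.mkQ (a • ⊤)) (exact_smulMap_mkQ a N₁) (Submodule.mkQ (a • ⊤)) (exact_smulMap_mkQ a N₂)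
      hg hf (QuotSMulTop.map a f) (QuotSMulTop.map_comp_mkQ a f) (Submodule.mkQ_surjective _)

end Snake

section Localized

variable (p : PrimeSpectrum R) {N₁ N₂ N₃ : Type*}
  [AddCommGroup N₁] [Module R N₁] [AddCommGroup N₂] [Module R N₂] [AddCommGroup N₃] [Module R N₃]

/-! ### Lengths of localisations -/

/-- Localisation at a prime is exact: for `0 → N₁ → N₂ → N₃ → 0` exact,
`ℓ_{R_p}((N₂)_p) = ℓ_{R_p}((N₁)_p) + ℓ_{R_p}((N₃)_p)` (Mathlib `IsLocalizedModule.map_exact` and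
additivity of length). [folklore] -/
lemma length_localized_eq_add (f : N₁ →ₗ[R] N₂) (g : N₂ →ₗ[R] N₃) (hf : Injective f)
    (hg : Surjective g) (hfg : Exact f g) :
    Module.length (Localization.AtPrime p.asIdeal) (LocalizedModule p.asIdeal.primeCompl N₂) =
      Module.length (Localization.AtPrime p.asIdeal) (LocalizedModule p.asIdeal.primeCompl N₁) +
        Module.length (Localization.AtPrime p.asIdeal) (LocalizedModule p.asIdeal.primeCompl N₃) := by
  refine Module.length_eq_add_of_exact
    ((IsLocalizedModule.map p.asIdeal.primeCompl (LocalizedModule.mkLinearMap p.asIdeal.primeCompl N₁)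
      (LocalizedModule.mkLinearMap p.asIdeal.primeCompl N₂) f).extendScalarsOfIsLocalization
      p.asIdeal.primeCompl (Localization.AtPrime p.asIdeal))
    ((IsLocalizedModule.map p.asIdeal.primeCompl (LocalizedModule.mkLinearMap p.asIdeal.primeCompl N₂)
      (LocalizedModule.mkLinearMap p.asIdeal.primeCompl N₃) g).extendScalarsOfIsLocalization
      p.asIdeal.primeCompl (Localization.AtPrime p.asIdeal)) ?_ ?_ ?_
  · exact IsLocalizedModule.map_injective _ _ _ f hf
  · exact IsLocalizedModule.map_surjective _ _ _ g hg
  · intro x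
    exact IsLocalizedModule.map_exact p.asIdeal.primeCompl (LocalizedModule.mkLinearMap _ N₁)
      (LocalizedModule.mkLinearMap _ N₂) (LocalizedModule.mkLinearMap _ N₃) f g hfg x

/-- An injection `N₁ ↪ N₂` gives `ℓ_{R_p}((N₁)_p) ≤ ℓ_{R_p}((N₂)_p)`. [folklore] -/
lemma length_localized_le_of_injective (f : N₁ →ₗ[R] N₂) (hf : Injective f) :
    Module.length (Localization.AtPrime p.asIdeal) (LocalizedModule p.asIdeal.primeCompl N₁) ≤
      Module.length (Localization.AtPrime p.asIdeal) (LocalizedModule p.asIdeal.primeCompl N₂) :=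
  Module.length_le_of_injective
    ((IsLocalizedModule.map p.asIdeal.primeCompl (LocalizedModule.mkLinearMap p.asIdeal.primeCompl N₁)
      (LocalizedModule.mkLinearMap p.asIdeal.primeCompl N₂) f).extendScalarsOfIsLocalization
      p.asIdeal.primeCompl (Localization.AtPrime p.asIdeal))
    (IsLocalizedModule.map_injective _ _ _ f hf)

/-- Isomorphic modules have localisations of the same length. [folklore] -/
lemma length_localized_eq_of_equiv (e : N₁ ≃ₗ[R] N₂) :
    Module.length (Localization.AtPrime p.asIdeal) (LocalizedModule p.asIdeal.primeCompl N₁) =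
      Module.length (Localization.AtPrime p.asIdeal) (LocalizedModule p.asIdeal.primeCompl N₂) :=
  le_antisymm (length_localized_le_of_injective p e.toLinearMap e.injective)
    (length_localized_le_of_injective p e.symm.toLinearMap e.symm.injective)

/-- `(R/I)_p = 0` if `I ⊄ p` (an element of `I \\ p` kills `R/I` and is a unit at `p`). [folklore] -/
lemma subsingleton_localized_quotient {I : Ideal R} (hI : ¬ I ≤ p.asIdeal) :
    Subsingleton (LocalizedModule p.asIdeal.primeCompl (R ⧸ I)) := by
  rw [IsLocalizedModule.subsingleton_iff p.asIdeal.primeCompl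
    (LocalizedModule.mkLinearMap p.asIdeal.primeCompl (R ⧸ I))]
  obtain ⟨s, hsI, hsp⟩ := Set.not_subset.mp hI
  intro m
  refine ⟨s, hsp, ?_⟩
  obtain ⟨m, rfl⟩ := Ideal.Quotient.mk_surjective m
  rw [Algebra.smul_def, Ideal.Quotient.algebraMap_eq, ← map_mul, Ideal.Quotient.eq_zero_iff_mem]
  exact I.mul_mem_right m hsI

/-- `(R/p)_p` has length one over `R_p`: it is the residue field `R_p/pR_p` (the cyclic
`R_p`-module on the class of `1`, nonzero, killed by the maximal ideal). [folklore] -/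
lemma length_localized_quotient_self :
    Module.length (Localization.AtPrime p.asIdeal)
      (LocalizedModule p.asIdeal.primeCompl (R ⧸ p.asIdeal)) = 1 := by
  set S := p.asIdeal.primeCompl
  set Rp := Localization.AtPrime p.asIdeal
  set L := LocalizedModule S (R ⧸ p.asIdeal)
  let x₀ : L := LocalizedModule.mk 1 1
  let φ : Rp →ₗ[Rp] L := LinearMap.toSpanSingleton Rp L x₀
  -- `φ` is surjective
  have hφ : Surjective φ := by
    intro x
    induction x using LocalizedModule.induction_on with
    | h m s =>
      obtain ⟨m, rfl⟩ := Ideal.Quotient.mk_surjective m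
      refine ⟨Localization.mk m s, ?_⟩
      simp only [φ, LinearMap.toSpanSingleton_apply, x₀]
      rw [LocalizedModule.mk_smul_mk, mul_one, Algebra.smul_def, Ideal.Quotient.algebraMap_eq,
        mul_one]
  -- its kernel is the maximal ideal
  have hx₀ : x₀ ≠ 0 := by
    intro h
    simp only [x₀] at h
    rw [← LocalizedModule.zero_mk 1, LocalizedModule.mk_eq] at h
    obtain ⟨u, hu⟩ := h
    simp only [smul_zero, one_smul] at hu
    rw [Submonoid.smul_def, Algebra.smul_def, Ideal.Quotient.algebraMap_eq, mul_one,
      Ideal.Quotient.eq_zero_iff_mem] at hu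
    exact u.2 hu
  have hker : LinearMap.ker φ = IsLocalRing.maximalIdeal Rp := by
    symm
    refine (IsLocalRing.maximalIdeal.isMaximal Rp).eq_of_le ?_ ?_
    · intro h
      apply hx₀
      have : (1 : Rp) ∈ LinearMap.ker φ := h ▸ Submodule.mem_top
      simpa [φ] using this
    · rw [← Localization.AtPrime.map_eq_maximalIdeal, Ideal.map_le_iff_le_comap]
      intro r hr
      simp only [Ideal.mem_comap, LinearMap.mem_ker, φ, x₀]
      rw [LinearMap.toSpanSingleton_apply, ← Localization.mk_one_eq_algebraMap,
        LocalizedModule.mk_smul_mk, one_mul, Algebra.smul_def, Ideal.Quotient.algebraMap_eq, mul_one,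
        Ideal.Quotient.eq_zero_iff_mem.mpr hr, LocalizedModule.zero_mk]
  have e : (Rp ⧸ IsLocalRing.maximalIdeal Rp) ≃ₗ[Rp] L := by
    rw [← hker]
    exact φ.quotKerEquivOfSurjective hφ
  haveI : IsSimpleModule Rp L :=
    isSimpleModule_iff_quot_maximal.mpr ⟨_, IsLocalRing.maximalIdeal.isMaximal Rp, ⟨e.symm⟩⟩
  exact Module.length_eq_one _ _

end Localized

end Literature.RingTheory.Length
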